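import Mathlib.GroupTheory.PresentedGroup
import Mathlib.Algebra.BigOperators.Group.List.Basic
import Literature.Topology.FourManifolds.GroupTrisections
import Literature.Algebra.Lie.SurfaceLieAlgebra
import HarnessLib

/-!
# Stub `stub_cutNormalForm` of line `saturated-torsor-descent` for crux
`CongruenceShadows.NilpotentShadowsStandard` (item stmt-SmoothPoincare4-14594)

**Cut normal form of the standard kernels.**  Let `S_g = ⟨a₁,b₁,…,a_g,b_g ∣ ∏[aᵢ,bᵢ]⟩`
(`Literature.Topology.FourManifolds.SurfaceGroup`), let `N = s4Kernels.stabilizeIter m` be the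
`m`-fold stabilisation of the genus-`3` trisection of `S⁴` (a kernel triple in `S_{3+3m}`), and
let `Cᵢ = s4CutSystem m i ⊆ Fin (3+3m) × Bool` be the `i`-th coordinate cut system (the pattern
`s4Gens i` repeated on each block of three handles: `(j, ε) ∈ Cᵢ ↔ (j mod 3, ε) ∈ s4Gens i`).
Then `Nᵢ` is the normal closure of the letters of `Cᵢ`:

  `s4Kernels.stabilizeIter m i = ⟪PresentedGroup.of '' s4CutSystem m i⟫`.

Proof: induction on `m`.  `m = 0` is `s4Kernels_eq` and `s4CutSystem_zero`.  For the step,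
`stabilizeIter (m+1) i = ⟪stabSet (Nᵢ) (s4Kernels i)⟫` (`stabilize_apply`), where `stabSet`
re-embeds free lifts of `Nᵢ` on the first `g = 3+3m` handles (`genIncl`) and free lifts of
`s4Kernels i` on the last three (`genShift`).
* `⊇`: a letter of `C_{m+1,i}` is either `(Fin.castAdd 3 j, ε)` with `(j, ε) ∈ C_{m,i}` or
  `(Fin.natAdd g j, ε)` with `(j, ε) ∈ s4Gens i`, i.e. the image of a generator lying in `Nᵢ`
  (induction hypothesis) resp. in `s4Kernels i`.
* `⊆` (`cutNormalForm_transfer`): for a handle relabelling `f : Fin n → Fin k` and a normal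
  `N ◁ S_k` containing one letter of every handle `f j` and the relabelled letters of `C`, the
  relabelling kills the genus-`n` relator modulo `N` (every commutator `[a_{fj}, b_{fj}]` has a
  trivial factor), hence descends to `θ : S_n → S_k ⧸ N` with `⟪C⟫ ≤ ker θ`; so every word whose
  class lies in `⟪C⟫` is relabelled into `N`.  Applied to `f = Fin.castAdd 3` and
  `f = Fin.natAdd g` with `N = ⟪C_{m+1,i}⟫`, which meets every handle (`s4Gens_hits`).

Pure bookkeeping over the tree's definitions; no new definitions, no named facts.
-/

-- the prescribed namespace `Summit.<P>.<Sub>.…` duplicates `SmoothPoincare4` (P = Sub)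
set_option linter.dupNamespace false

open Literature.Topology.FourManifolds Literature.Algebra.Lie Subgroup

namespace Summit.SmoothPoincare4.SmoothPoincare4.Theorems.NilpotentShadowsStandard.SaturatedTorsorDescent

/-- A hom out of the free group on the genus-`n` letters that kills one letter of every handle
kills the surface relator `∏ [aⱼ, bⱼ]` (each commutator has a trivial factor). [folklore] -/
theorem cutNormalForm_relator {n : ℕ} {T : Type*} [Group T]
    (Φ : FreeGroup (surfaceGen n) →* T) (hgen : ∀ j : Fin n, Φ (genA j) = 1 ∨ Φ (genB j) = 1) :
    Φ (surfaceRelator n) = 1 := by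
  unfold surfaceRelator
  rw [map_list_prod, List.map_map]
  refine List.prod_eq_one fun y hy => ?_
  obtain ⟨j, -, rfl⟩ := List.mem_map.1 hy
  rcases hgen j with h | h <;> simp [h]

/-- **Letter transfer.**  Let `f : Fin n → Fin k` relabel handles and let the normal subgroup
`N ◁ S_k` contain, for every handle `j < n`, one of the letters `a_{f j}, b_{f j}`, and every
relabelled letter `(f p.1, p.2)`, `p ∈ C`.  Then the relabelling `FreeGroup.map (p ↦ (f p.1, p.2))`
sends every word whose class in `S_n` lies in `⟪C⟫` to a word whose class in `S_k` lies in `N`: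
the relabelling kills the genus-`n` relator modulo `N`, so it descends to `θ : S_n → S_k ⧸ N`
(`presentedLift`), and `⟪C⟫ ≤ ker θ`. [folklore] -/
theorem cutNormalForm_transfer {n k : ℕ} (f : Fin n → Fin k) (C : Set (surfaceGen n))
    (N : Subgroup (SurfaceGroup k)) [N.Normal]
    (hN : ∀ j : Fin n, (PresentedGroup.of (f j, false) : SurfaceGroup k) ∈ N ∨
      (PresentedGroup.of (f j, true) : SurfaceGroup k) ∈ N)
    (hC : ∀ p ∈ C, (PresentedGroup.of (f p.1, p.2) : SurfaceGroup k) ∈ N)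
    (x : FreeGroup (surfaceGen n))
    (hx : PresentedGroup.mk _ x ∈ normalClosure (PresentedGroup.of '' C : Set (SurfaceGroup n))) :
    PresentedGroup.mk _ (FreeGroup.map (fun p : surfaceGen n => (f p.1, p.2)) x) ∈ N := by
  -- the relabelling followed by the projections `F_k → S_k → S_k ⧸ N`
  set Φ : FreeGroup (surfaceGen n) →* SurfaceGroup k ⧸ N :=
    (QuotientGroup.mk' N).comp ((PresentedGroup.mk _).comp
      (FreeGroup.map fun p : surfaceGen n => (f p.1, p.2))) with hΦ
  have hΦof : ∀ p : surfaceGen n, Φ (FreeGroup.of p) = 1 ↔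
      (PresentedGroup.of (f p.1, p.2) : SurfaceGroup k) ∈ N := by
    intro p
    rw [hΦ, MonoidHom.comp_apply, MonoidHom.comp_apply, FreeGroup.map.of, QuotientGroup.mk'_apply,
      QuotientGroup.eq_one_iff]
    rfl
  -- one letter of each handle dies in `S_k ⧸ N`, hence so does the relator
  have hrel : ∀ r ∈ ({surfaceRelator n} : Set (FreeGroup (surfaceGen n))), Φ r = 1 := by
    intro r hr
    rw [Set.mem_singleton_iff] at hr
    rw [hr]
    exact cutNormalForm_relator Φ fun j => (hN j).imp (hΦof (j, false)).2 (hΦof (j, true)).2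
  -- `⟪C⟫ ≤ ker θ` for the descended map `θ = presentedLift Φ hrel : S_n → S_k ⧸ N`
  have hker : normalClosure (PresentedGroup.of '' C : Set (SurfaceGroup n)) ≤
      (presentedLift Φ hrel).ker := by
    refine normalClosure_le_normal ?_
    rintro _ ⟨p, hp, rfl⟩
    rw [SetLike.mem_coe, MonoidHom.mem_ker, presentedLift_of]
    exact (hΦof p).2 (hC p hp)
  have h := hker hx
  rw [MonoidHom.mem_ker, presentedLift_mk, hΦ, MonoidHom.comp_apply, MonoidHom.comp_apply,
    QuotientGroup.mk'_apply, QuotientGroup.eq_one_iff] at h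
  exact h

/-- **One stabilisation step in cut normal form.**  If `C' ⊆ Fin (g+3) × Bool` consists exactly
of the letters of `C ⊆ Fin g × Bool` re-embedded on the first `g` handles and the letters of
`C₃ ⊆ Fin 3 × Bool` shifted to the last three, and `C'` meets every handle, then
`⟪stabSet ⟪C⟫ ⟪C₃⟫⟫ = ⟪C'⟫` in `S_{g+3}`. [folklore] -/
theorem cutNormalForm_step {g : ℕ} (C : Set (surfaceGen g)) (C₃ : Set (surfaceGen 3))
    (C' : Set (surfaceGen (g + 3)))
    (ha : ∀ p ∈ C, (Fin.castAdd 3 p.1, p.2) ∈ C')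
    (hb : ∀ p ∈ C₃, (Fin.natAdd g p.1, p.2) ∈ C')
    (hc : ∀ q ∈ C', (∃ p ∈ C, (Fin.castAdd 3 p.1, p.2) = q) ∨
      (∃ p ∈ C₃, (Fin.natAdd g p.1, p.2) = q))
    (hd : ∀ j : Fin (g + 3), (j, false) ∈ C' ∨ (j, true) ∈ C') :
    normalClosure (stabSet (↑(normalClosure (PresentedGroup.of '' C : Set (SurfaceGroup g))))
        (↑(normalClosure (PresentedGroup.of '' C₃ : Set (SurfaceGroup 3))))) =
      normalClosure (PresentedGroup.of '' C' : Set (SurfaceGroup (g + 3))) := by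
  have hN : ∀ q ∈ C', (PresentedGroup.of q : SurfaceGroup (g + 3)) ∈
      normalClosure (PresentedGroup.of '' C' : Set (SurfaceGroup (g + 3))) :=
    fun q hq => subset_normalClosure ⟨q, hq, rfl⟩
  apply le_antisymm
  · refine normalClosure_le_normal ?_
    rintro s (⟨x, hx, rfl⟩ | ⟨x, hx, rfl⟩)
    · exact cutNormalForm_transfer (Fin.castAdd 3) C _
        (fun j => (hd (Fin.castAdd 3 j)).imp (hN _) (hN _)) (fun p hp => hN _ (ha p hp)) x hx
    · exact cutNormalForm_transfer (Fin.natAdd g) C₃ _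
        (fun j => (hd (Fin.natAdd g j)).imp (hN _) (hN _)) (fun p hp => hN _ (hb p hp)) x hx
  · refine normalClosure_mono ?_
    rintro _ ⟨q, hq, rfl⟩
    rcases hc q hq with ⟨p, hp, rfl⟩ | ⟨p, hp, rfl⟩
    · refine Or.inl ⟨FreeGroup.of p, subset_normalClosure ⟨p, hp, rfl⟩, ?_⟩
      simp only [Function.comp_apply, genIncl_of]
      rfl
    · refine Or.inr ⟨FreeGroup.of p, subset_normalClosure ⟨p, hp, rfl⟩, ?_⟩
      simp only [Function.comp_apply, genShift_of]
      rfl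

/-- Membership of a letter of genus `3 + 3m + 3` in the level-`m+1` coordinate cut system,
unfolded (the genus `3 + 3(m+1)` is read as `(3 + 3m) + 3`, as in `stabilizeIter`). [folklore] -/
private theorem mk_mem_s4CutSystem_succ_iff (m : ℕ) (i : Fin 3) (j : Fin (3 + 3 * m + 3))
    (b : Bool) :
    (j, b) ∈ (s4CutSystem (m + 1) i : Set (surfaceGen (3 + 3 * m + 3))) ↔
      ((⟨(j : ℕ) % 3, Nat.mod_lt _ (by decide)⟩ : Fin 3), b) ∈ s4Gens i :=
  Iff.rfl

/-- Re-embedding a letter on the first `3 + 3m` handles does not change the residue of its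
handle mod `3`, hence not its membership in the coordinate cut system. [folklore] -/
private theorem castAdd_mem_s4CutSystem_iff (m : ℕ) (i : Fin 3) (j : Fin (3 + 3 * m)) (b : Bool) :
    (Fin.castAdd 3 j, b) ∈ (s4CutSystem (m + 1) i : Set (surfaceGen (3 + 3 * m + 3))) ↔
      (j, b) ∈ s4CutSystem m i :=
  Iff.rfl

/-- A letter shifted to the last three handles of `S_{3+3m+3}` lies in the coordinate cut
system iff it lies in the genus-`3` pattern `s4Gens i` (`(3 + 3m + j) mod 3 = j`). [folklore] -/
private theorem natAdd_mem_s4CutSystem_iff (m : ℕ) (i : Fin 3) (j : Fin 3) (b : Bool) :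
    (Fin.natAdd (3 + 3 * m) j, b) ∈ (s4CutSystem (m + 1) i : Set (surfaceGen (3 + 3 * m + 3))) ↔
      (j, b) ∈ s4Gens i := by
  have hj : (3 + 3 * m + (j : ℕ)) % 3 = j := by have := j.is_lt; omega
  rw [mk_mem_s4CutSystem_succ_iff]
  simp only [Fin.val_natAdd, hj, Fin.eta]

/-- **Cut normal form** (registered stub `stub_cutNormalForm` = `CutNormalForm`): the `i`-th
kernel of the `m`-fold stabilisation of the genus-`3` trisection of `S⁴` is the normal closure
of the letters of the `i`-th coordinate cut system,
`s4Kernels.stabilizeIter m i = ⟪s4CutSystem m i⟫`. [folklore] -/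
theorem stub_cutNormalForm : ∀ (m : ℕ) (i : Fin 3), Literature.Topology.FourManifolds.s4Kernels.stabilizeIter m i = Subgroup.normalClosure (PresentedGroup.of '' Literature.Algebra.Lie.s4CutSystem m i) := by
  intro m i
  induction m with
  | zero =>
    rw [s4CutSystem_zero]
    exact s4Kernels_eq i
  | succ m ih =>
    change (s4Kernels.stabilizeIter m).stabilize i = _
    rw [TrisectionKernels.stabilize_apply, ih, s4Kernels_eq]
    refine cutNormalForm_step (s4CutSystem m i) ↑(s4Gens i) (s4CutSystem (m + 1) i)
      ?_ ?_ ?_ ?_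
    · intro p hp
      exact (castAdd_mem_s4CutSystem_iff m i p.1 p.2).2 hp
    · intro p hp
      exact (natAdd_mem_s4CutSystem_iff m i p.1 p.2).2 hp
    · rintro ⟨j, b⟩ hq
      induction j using Fin.addCases with
      | left j => exact Or.inl ⟨(j, b), (castAdd_mem_s4CutSystem_iff m i j b).1 hq, rfl⟩
      | right j => exact Or.inr ⟨(j, b), (natAdd_mem_s4CutSystem_iff m i j b).1 hq, rfl⟩
    · exact fun j => s4Gens_hits i _

end Summit.SmoothPoincare4.SmoothPoincare4.Theorems.NilpotentShadowsStandard.SaturatedTorsorDescent
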